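import Summits.HubbardSuperconductivity.HubbardSuperconductivity.Theorems.JosephsonMirrorJmPairBridgeSpaceGroupFamily
import Summits.HubbardSuperconductivity.HubbardSuperconductivity.Theorems.JosephsonMirrorJmPairBridgeFloorGap
import Summits.HubbardSuperconductivity.HubbardSuperconductivity.Theorems.JosephsonMirrorJmPairBridgeNoSplitNearGeneric
import Summits.HubbardSuperconductivity.HubbardSuperconductivity.Theorems.JosephsonMirrorJmPairBridgeFloorUpper
import Summits.HubbardSuperconductivity.HubbardSuperconductivity.Theorems.JosephsonMirrorJmPairBridgeFloorLower
import Summits.HubbardSuperconductivity.HubbardSuperconductivity.Theorems.JosephsonMirrorJmPairBridgeFloorTransport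
import Summits.HubbardSuperconductivity.HubbardSuperconductivity.Theorems.BalabanIRBirEveryGroundStateAffine
import Literature.MathematicalPhysics.QuantumLattice.FreeFermiGasNoThermalPairFieldLRO
import HarnessLib

/-!
# Crux `JmPairBridge` (stmt-HubbardSuperconductivity-2226), line `schur-rigid-bridge`:
# irreducibility of the floor is locally constant near a non-exceptional coupling

Route `JosephsonMirror`, crux `JmPairBridge` (thesis X: the every-ground-state d-wave pair bridge between the
`(N_L, 0)` and `(N_L - 2, 0)` ground floors of `hubbardTorus 2 L 1 U`). This file composes the five landed
finite-dimensional stubs of line `schur-rigid-bridge` (`stub_floorGap`, `stub_noSplitNearGeneric`,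
`stub_floorUpper`, `stub_floorLower`, `stub_floorTransport`) into the line's propagation theorem:

* `orthogonal_injective_symm`, `irreducible_iff_of_compression` — the injective orthogonal compression between
  two equal-dimensional floors is injective the other way too, so irreducibility under a family of unitaries
  preserving both is transported in BOTH directions (`stub_floorTransport` twice);
* `irreducibilityLocallyConstant` — for `H = hubbardTorus 2 L 1 u` on the sector `szSector N 0`, near a coupling
  `U₀` with the maximal number of distinct eigenvalues the `(N, 0)` ground floor at `u` is space-group irreducible
  iff the floor at `U₀` is (Kato's continuity of the λ-group at a point without splitting, inside the invariant
  sector: `stub_noSplitNearGeneric`, `stub_floorGap`, `stub_floorUpper`, `stub_floorLower`);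
* `reducibleFloorPropagates` — hence space-group REDUCIBILITY of the floor is an open condition near a
  non-exceptional coupling (the planner's `stub_reducibleFloorPropagates` in its correct local form; the global
  form is false when the bottom branch of the sector changes at a crossing).

The selection of the coupling and the crux from the line's two residues are in
`Theorems/JosephsonMirrorJmPairBridgeWindowResidue.lean`.

Sources: T. Kato, *Perturbation Theory for Linear Operators* (1966), Ch. II §§1.1, 5.1–5.2; J.-P. Serre,
*Linear Representations of Finite Groups* §2.2; H. Tasaki, *Physics and Mathematics of Quantum Many-Body
Systems* (2020) §2.1. No definition, no named fact.
-/

noncomputable section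

-- the mandated namespace `Summit.<Summit>.<Problem>.Theorems` repeats `HubbardSuperconductivity`
-- (single-problem summit, D-0017), which the `dupNamespace` linter flags on every declaration
set_option linter.dupNamespace false

namespace Summit.HubbardSuperconductivity.HubbardSuperconductivity.Theorems.JosephsonMirror

open Matrix Literature.MathematicalPhysics.QuantumLattice Literature.Probability.LatticeModels
open Literature.MathematicalPhysics.QuantumLattice.EigenvalueContinuation
open scoped ComplexOrder

/-- Every space-group unitary `U_γ U_v` maps the `(N, 0)` ground floor of `hubbardTorus 2 L 1 U` into itself
(it commutes with `H` and preserves the sector). Tasaki (2020) §2.1. [folklore] -/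
theorem spaceGroup_mulVec_mem_floor {L : ℕ} [NeZero L] (U : ℝ) (N : ℕ) (γ : DihedralGroup 4)
    (v : TorusSite 2 L) :
    ∀ w ∈ szSector N 0 ⊓ Module.End.eigenspace (Matrix.toLin' (hubbardTorus 2 L 1 U))
        (((hubbardTorus 2 L 1 U).minEnergyOn (szSector N 0) : ℝ) : ℂ),
      ((fockD4 γ).val * (fockTranslate v).val) *ᵥ w ∈
        szSector N 0 ⊓ Module.End.eigenspace (Matrix.toLin' (hubbardTorus 2 L 1 U))
          (((hubbardTorus 2 L 1 U).minEnergyOn (szSector N 0) : ℝ) : ℂ) := by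
  intro w hw
  obtain ⟨-, hcomm, hsec, -, -⟩ := spaceGroup_symmetryProps γ v U N
  rw [Submodule.mem_inf, Module.End.mem_eigenspace_iff, Matrix.toLin'_apply] at hw ⊢
  refine ⟨hsec w hw.1, ?_⟩
  rw [mulVec_mulVec, ← hcomm, ← mulVec_mulVec, hw.2, mulVec_smul]

/-- **Symmetry of the injective compression.** If `F₀`, `F₁` have equal dimension and no non-zero vector
of `F₁` is orthogonal to `F₀`, then no non-zero vector of `F₀` is orthogonal to `F₁` (the orthogonal
compression `F₁ → F₀` is then bijective, and `⟨v, v⟩ = ⟨v, P₀ w⟩ = ⟨v, w⟩ = 0` for `v = P₀ w ⊥ F₁`).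
[folklore] -/
theorem orthogonal_injective_symm {ι : Type*} [Fintype ι] [DecidableEq ι] (F₀ F₁ : Submodule ℂ (ι → ℂ))
    (hdim : Module.finrank ℂ ↥F₁ = Module.finrank ℂ ↥F₀)
    (hinj : ∀ v ∈ F₁, (∀ w ∈ F₀, star w ⬝ᵥ v = 0) → v = 0) :
    ∀ v ∈ F₀, (∀ w ∈ F₁, star w ⬝ᵥ v = 0) → v = 0 := by
  classical
  set P : Matrix ι ι ℂ := projMatrix (F₀.map ((WithLp.linearEquiv 2 ℂ (ι → ℂ)).symm :
      (ι → ℂ) →ₗ[ℂ] EuclideanSpace ℂ ι)) with hPdef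
  have hPH : P.IsHermitian := projMatrix_isHermitian _
  have hPmem : ∀ x, P *ᵥ x ∈ F₀ := fun x => projMatrix_map_mulVec_mem F₀ x
  have hPfix : ∀ x ∈ F₀, P *ᵥ x = x := fun x hx => projMatrix_map_mulVec_of_mem F₀ hx
  have hadj : ∀ w u : ι → ℂ, star (P *ᵥ w) ⬝ᵥ u = star w ⬝ᵥ P *ᵥ u := fun w u => by
    rw [star_mulVec, ← dotProduct_mulVec, hPH.eq]
  -- the compression `F₁ → F₀`, injective by `hinj`, hence surjective by the dimension count
  let π : ↥F₁ →ₗ[ℂ] ↥F₀ :=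
    LinearMap.codRestrict F₀ ((Matrix.toLin' P).domRestrict F₁) fun x => hPmem _
  have hπv : ∀ x : ↥F₁, ((π x : ↥F₀) : ι → ℂ) = P *ᵥ (x : ι → ℂ) := fun x => rfl
  have hπinj : Function.Injective π := by
    intro x y hxy
    apply Subtype.ext
    have h : P *ᵥ (x : ι → ℂ) = P *ᵥ (y : ι → ℂ) := by
      rw [← hπv, ← hπv, hxy]
    have hsub : P *ᵥ ((x : ι → ℂ) - y) = 0 := by rw [mulVec_sub, h, sub_self]
    refine sub_eq_zero.1 (hinj _ (F₁.sub_mem x.2 y.2) fun w hw => ?_)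
    rw [← hPfix w hw, hadj, hsub, dotProduct_zero]
  have hπsurj : Function.Surjective π :=
    (LinearMap.injective_iff_surjective_of_finrank_eq_finrank hdim).1 hπinj
  intro v hv horth
  obtain ⟨w, hw⟩ := hπsurj ⟨v, hv⟩
  have hwv : P *ᵥ (w : ι → ℂ) = v := by
    rw [← hπv, hw]
  have hconj : star v ⬝ᵥ (w : ι → ℂ) = star (star (w : ι → ℂ) ⬝ᵥ v) := by
    rw [← star_dotProduct_star, star_star]
  have h0 : star v ⬝ᵥ v = 0 := by
    calc star v ⬝ᵥ v = star v ⬝ᵥ P *ᵥ (w : ι → ℂ) := by rw [hwv]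
      _ = star (P *ᵥ v) ⬝ᵥ (w : ι → ℂ) := (hadj v w).symm
      _ = star v ⬝ᵥ (w : ι → ℂ) := by rw [hPfix v hv]
      _ = 0 := by rw [hconj, horth w w.2, star_zero]
  exact dotProduct_star_self_eq_zero.1 h0

/-- **Irreducibility is transported both ways** through an injective equivariant compression between floors of
equal dimension (`stub_floorTransport` in both directions, the reverse one via `orthogonal_injective_symm`).
Serre §2.2. [folklore] -/
theorem irreducible_iff_of_compression {ι : Type*} [Fintype ι] [DecidableEq ι]
    (F₀ F₁ : Submodule ℂ (ι → ℂ)) (S : Set (Matrix ι ι ℂ)) (hSU : ∀ X ∈ S, Xᴴ * X = 1)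
    (hS₀ : ∀ X ∈ S, ∀ v ∈ F₀, X *ᵥ v ∈ F₀) (hS₁ : ∀ X ∈ S, ∀ v ∈ F₁, X *ᵥ v ∈ F₁)
    (hdim : Module.finrank ℂ ↥F₁ = Module.finrank ℂ ↥F₀)
    (hinj : ∀ v ∈ F₁, (∀ w ∈ F₀, star w ⬝ᵥ v = 0) → v = 0) :
    (∀ K' : Submodule ℂ (ι → ℂ), K' ≤ F₁ → (∀ X ∈ S, ∀ v ∈ K', X *ᵥ v ∈ K') → K' = ⊥ ∨ K' = F₁) ↔
      (∀ K' : Submodule ℂ (ι → ℂ), K' ≤ F₀ → (∀ X ∈ S, ∀ v ∈ K', X *ᵥ v ∈ K') → K' = ⊥ ∨ K' = F₀) :=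
  ⟨stub_floorTransport F₀ F₁ S hSU hS₀ hS₁ hdim hinj,
    stub_floorTransport F₁ F₀ S hSU hS₁ hS₀ hdim.symm (orthogonal_injective_symm F₀ F₁ hdim hinj)⟩

/-- **Space-group irreducibility of the floor is locally constant near a non-exceptional coupling.** For the
torus side `L`, a particle number `N` and a coupling `U₀` at which the number of distinct eigenvalues of
`hubbardTorus 2 L 1 U₀` is maximal over all real couplings, the `(N, 0)` ground floor at a coupling `u` near
`U₀` is irreducible under the space group iff the floor at `U₀` is (Kato's continuity of the λ-group at a point
without splitting, in the invariant sector, + equivariant transport of irreducibility through the orthogonal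
compression, both ways). Kato (1966) II §§1.1, 5.1; Serre §2.2. [folklore] -/
theorem irreducibilityLocallyConstant (L : ℕ) [NeZero L] (N : ℕ) (U₀ : ℝ)
    (hgen : ∀ u' : ℝ, (hubbardTorus 2 L 1 u').charpoly.roots.toFinset.card ≤
      (hubbardTorus 2 L 1 U₀).charpoly.roots.toFinset.card) :
    ∃ ε : ℝ, 0 < ε ∧ ∀ u ∈ Set.Ioo (U₀ - ε) (U₀ + ε),
      ((∀ K' : Submodule ℂ (Fock (Orb (FermionTorus 2 L))),
        K' ≤ szSector N 0 ⊓ Module.End.eigenspace (Matrix.toLin' (hubbardTorus 2 L 1 u))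
            (((hubbardTorus 2 L 1 u).minEnergyOn (szSector N 0) : ℝ) : ℂ) →
        (∀ (γ : DihedralGroup 4) (v : TorusSite 2 L), ∀ w ∈ K',
          ((fockD4 γ).val * (fockTranslate v).val) *ᵥ w ∈ K') →
        K' = ⊥ ∨ K' = szSector N 0 ⊓ Module.End.eigenspace (Matrix.toLin' (hubbardTorus 2 L 1 u))
            (((hubbardTorus 2 L 1 u).minEnergyOn (szSector N 0) : ℝ) : ℂ)) ↔
      (∀ K' : Submodule ℂ (Fock (Orb (FermionTorus 2 L))),
        K' ≤ szSector N 0 ⊓ Module.End.eigenspace (Matrix.toLin' (hubbardTorus 2 L 1 U₀))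
            (((hubbardTorus 2 L 1 U₀).minEnergyOn (szSector N 0) : ℝ) : ℂ) →
        (∀ (γ : DihedralGroup 4) (v : TorusSite 2 L), ∀ w ∈ K',
          ((fockD4 γ).val * (fockTranslate v).val) *ᵥ w ∈ K') →
        K' = ⊥ ∨ K' = szSector N 0 ⊓ Module.End.eigenspace (Matrix.toLin' (hubbardTorus 2 L 1 U₀))
            (((hubbardTorus 2 L 1 U₀).minEnergyOn (szSector N 0) : ℝ) : ℂ))) := by
  classical
  -- the family, the sector, the sector energies
  set H : ℝ → Matrix (Finset (Orb (FermionTorus 2 L))) (Finset (Orb (FermionTorus 2 L))) ℂ :=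
    fun u => hubbardTorus 2 L 1 u with hHdef
  set K : Submodule ℂ (Fock (Orb (FermionTorus 2 L))) := szSector N 0 with hKdef
  set m : ℝ → ℝ := fun u => (hubbardTorus 2 L 1 u).minEnergyOn (szSector N 0) with hmdef
  have hHu : ∀ u, H u = hubbardTorus 2 L 1 u := fun u => rfl
  have hmu : ∀ u, m u = (H u).minEnergyOn K := fun u => rfl
  -- degenerate case: the sector has no unit vector, every floor is `⊥`, irreducibility is trivial everywhere
  by_cases hK : ∃ ψ ∈ K, star ψ ⬝ᵥ ψ = 1
  swap
  · have htriv : ∀ u' : ℝ, ∀ K' : Submodule ℂ (Fock (Orb (FermionTorus 2 L))),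
        K' ≤ K ⊓ Module.End.eigenspace (Matrix.toLin' (H u')) ((m u' : ℝ) : ℂ) →
        (∀ (γ : DihedralGroup 4) (v : TorusSite 2 L), ∀ w ∈ K',
          ((fockD4 γ).val * (fockTranslate v).val) *ᵥ w ∈ K') →
        K' = ⊥ ∨ K' = K ⊓ Module.End.eigenspace (Matrix.toLin' (H u')) ((m u' : ℝ) : ℂ) := by
      intro u' K' hK' _
      refine Or.inl ?_
      rw [Submodule.eq_bot_iff]
      intro w hw
      by_contra hw0
      obtain ⟨c, -, -, hunit⟩ := exists_normalize hw0
      exact hK ⟨(c : ℂ) • w, K.smul_mem _ (Submodule.mem_inf.mp (hK' hw)).1, hunit⟩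
    exact ⟨1, one_pos, fun u _ => iff_of_true (htriv u) (htriv U₀)⟩
  -- the abstract data of the pencil `u ↦ H u` on the invariant sector `K`
  have hherm : ∀ u, (H u)ᴴ = H u := fun u =>
    (LiebThm1.hamiltonian_isHermitian (fermionTorusGraph 2 L) 1 u).eq
  have hinv : ∀ u, ∀ v ∈ K, H u *ᵥ v ∈ K := fun u v hv => hubbardTorus_mulVec_mem_szSector 1 u hv
  have hlip : ∀ (u u' : ℝ) (v : Fock (Orb (FermionTorus 2 L))),
      |(star v ⬝ᵥ H u *ᵥ v).re - (star v ⬝ᵥ H u' *ᵥ v).re| ≤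
        (Fintype.card (FermionTorus 2 L) : ℝ) * |u - u'| * (star v ⬝ᵥ v).re :=
    fun u u' v => abs_re_expect_hamiltonian_sub_le (fermionTorusGraph 2 L) 1 u u' v
  have hm : ∀ (u : ℝ), ∀ v ∈ K, m u * (star v ⬝ᵥ v).re ≤ (star v ⬝ᵥ H u *ᵥ v).re :=
    fun u v hv => minEnergyOn_mul_re_le (H u) K hv
  have hatt : ∀ u : ℝ, ∃ ψ ∈ K, ψ ≠ 0 ∧ H u *ᵥ ψ = (m u : ℂ) • ψ := by
    intro u
    obtain ⟨ψ₀, hψ₀K, hψ₀⟩ := hK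
    have hne : {w : Fock (Orb (FermionTorus 2 L)) | w ∈ K ∧ star w ⬝ᵥ w = 1}.Nonempty :=
      ⟨ψ₀, hψ₀K, hψ₀⟩
    obtain ⟨w, hw, hmin⟩ :=
      (isCompact_unitSphere_inter K).exists_isMinOn hne (continuous_energy (H u)).continuousOn
    have hwle : (star w ⬝ᵥ H u *ᵥ w).re ≤ m u * (star w ⬝ᵥ w).re := by
      rw [hw.2, Complex.one_re, mul_one, hmu u, Matrix.minEnergyOn]
      refine le_csInf ⟨_, w, hw.1, hw.2, rfl⟩ ?_
      rintro E ⟨ψ, hψK, hψ1, rfl⟩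
      exact (isMinOn_iff.mp hmin) ψ ⟨hψK, hψ1⟩
    have hw0 : w ≠ 0 := by
      rintro rfl
      have h := hw.2
      rw [dotProduct_zero] at h
      exact zero_ne_one h
    exact ⟨w, hw.1, hw0, mulVec_eq_smul_of_forall_le_on (hherm u) K (hinv u) (hm u) hw.1 hwle⟩
  -- stub 3 at every coupling, stub 4 at `U₀`
  have hgapAll : ∀ u : ℝ, ∃ μ : ℝ, m u < μ ∧
      (∀ w ∈ K, (∀ ψ ∈ K, H u *ᵥ ψ = (m u : ℂ) • ψ → star ψ ⬝ᵥ w = 0) →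
        μ * (star w ⬝ᵥ w).re ≤ (star w ⬝ᵥ H u *ᵥ w).re) ∧
      ((∀ w ∈ K, (∀ ψ ∈ K, H u *ᵥ ψ = (m u : ℂ) • ψ → star ψ ⬝ᵥ w = 0) → w = 0) ∨
        (∃ φ ∈ K, φ ≠ 0 ∧ (∀ ψ ∈ K, H u *ᵥ ψ = (m u : ℂ) • ψ → star ψ ⬝ᵥ φ = 0) ∧
          H u *ᵥ φ = (μ : ℂ) • φ)) :=
    fun u => stub_floorGap (H u) (hherm u) K (hinv u) (m u) (hm u)
  have hcont : Continuous H := by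
    have hpen : H = fun u : ℝ => hubbardTorus 2 L 1 0 +
        ((u : ℝ) : ℂ) • ∑ x : FermionTorus 2 L, numberOp x 0 * numberOp x 1 := by
      funext u
      exact hamiltonian_eq_add_smul_doublon (fermionTorusGraph 2 L) 1 u
    rw [hpen]
    exact continuous_const.add (Complex.continuous_ofReal.smul continuous_const)
  obtain ⟨ρ, hρ, hns⟩ := stub_noSplitNearGeneric H
    (fun u => LiebThm1.hamiltonian_isHermitian (fermionTorusGraph 2 L) 1 u) hcont U₀ hgen (m U₀)
    (by obtain ⟨ψ, -, hψ0, hψ⟩ := hatt U₀; exact ⟨ψ, hψ0, hψ⟩)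
  obtain ⟨μ₀, hμ₀, hgap₀, -⟩ := hgapAll U₀
  obtain ⟨ε₁, hε₁, hup⟩ := stub_floorUpper H hherm K hinv _ (Nat.cast_nonneg _) hlip m hm hatt U₀ μ₀
    hμ₀ hgap₀
  obtain ⟨ε₂, hε₂, hlow⟩ := stub_floorLower H hherm K hinv _ (Nat.cast_nonneg _) hlip m hm hatt
    hgapAll U₀ ρ hρ hns
  refine ⟨min ε₁ ε₂, lt_min hε₁ hε₂, fun u hu => ?_⟩
  have hu' : |u - U₀| < min ε₁ ε₂ := by
    rw [abs_lt]
    constructor <;> linarith [hu.1, hu.2]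
  obtain ⟨hinj, hle⟩ := hup u (lt_of_lt_of_le hu' (min_le_left _ _))
  have hge := hlow u (lt_of_lt_of_le hu' (min_le_right _ _))
  -- stub 7 along the space group, both ways
  set S : Set (Matrix (Finset (Orb (FermionTorus 2 L))) (Finset (Orb (FermionTorus 2 L))) ℂ) :=
    {X | ∃ (γ : DihedralGroup 4) (v : TorusSite 2 L), X = (fockD4 γ).val * (fockTranslate v).val}
    with hSdef
  have hSU : ∀ X ∈ S, Xᴴ * X = 1 := by
    rintro X ⟨γ, v, rfl⟩
    exact conjTranspose_spaceGroup_mul_self γ v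
  have hSfl : ∀ u' : ℝ, ∀ X ∈ S,
      ∀ w ∈ K ⊓ Module.End.eigenspace (Matrix.toLin' (H u')) ((m u' : ℝ) : ℂ),
        X *ᵥ w ∈ K ⊓ Module.End.eigenspace (Matrix.toLin' (H u')) ((m u' : ℝ) : ℂ) := by
    rintro u' X ⟨γ, v, rfl⟩ w hw
    exact spaceGroup_mulVec_mem_floor u' N γ v w hw
  have key := irreducible_iff_of_compression
    (K ⊓ Module.End.eigenspace (Matrix.toLin' (H U₀)) ((m U₀ : ℝ) : ℂ))
    (K ⊓ Module.End.eigenspace (Matrix.toLin' (H u)) ((m u : ℝ) : ℂ)) S hSU (hSfl U₀) (hSfl u)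
    (le_antisymm hle hge) hinj
  -- the `S`-form of irreducibility used by the abstract lemmas is the space-group form of the statement
  have hconv : ∀ F : Submodule ℂ (Fock (Orb (FermionTorus 2 L))),
      (∀ K' : Submodule ℂ (Fock (Orb (FermionTorus 2 L))), K' ≤ F →
        (∀ X ∈ S, ∀ v ∈ K', X *ᵥ v ∈ K') → K' = ⊥ ∨ K' = F) ↔
      (∀ K' : Submodule ℂ (Fock (Orb (FermionTorus 2 L))), K' ≤ F →
        (∀ (γ : DihedralGroup 4) (v : TorusSite 2 L), ∀ w ∈ K',
          ((fockD4 γ).val * (fockTranslate v).val) *ᵥ w ∈ K') → K' = ⊥ ∨ K' = F) := by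
    intro F
    constructor
    · intro h K' hK' hK'inv
      exact h K' hK' fun X hX w hw => by
        obtain ⟨γ, v, rfl⟩ := hX
        exact hK'inv γ v w hw
    · intro h K' hK' hK'inv
      exact h K' hK' fun γ v w hw => hK'inv _ ⟨γ, v, rfl⟩ w hw
  rw [← hconv, ← hconv]
  exact key

/-- **Reducibility of the floor is an open condition near a non-exceptional coupling** (the planner's
`stub_reducibleFloorPropagates`, in its local form — the global form "reducible at every coupling" is false
when the bottom branch changes at a crossing). For the torus side `L`, a particle number `N` and a coupling
`U₀` at which the number of distinct eigenvalues of `hubbardTorus 2 L 1 U₀` is maximal over all real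
couplings: if the `(N, 0)` ground floor at `U₀` is reducible under the space group, so is the floor at every
coupling near `U₀` (`irreducibilityLocallyConstant`). Kato (1966) II §§1.1, 5.1; Serre §2.2. [folklore] -/
theorem reducibleFloorPropagates (L : ℕ) [NeZero L] (N : ℕ) (U₀ : ℝ)
    (hgen : ∀ u' : ℝ, (hubbardTorus 2 L 1 u').charpoly.roots.toFinset.card ≤
      (hubbardTorus 2 L 1 U₀).charpoly.roots.toFinset.card)
    (hred : ¬ (∀ K' : Submodule ℂ (Fock (Orb (FermionTorus 2 L))),
      K' ≤ szSector N 0 ⊓ Module.End.eigenspace (Matrix.toLin' (hubbardTorus 2 L 1 U₀))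
          (((hubbardTorus 2 L 1 U₀).minEnergyOn (szSector N 0) : ℝ) : ℂ) →
      (∀ (γ : DihedralGroup 4) (v : TorusSite 2 L), ∀ w ∈ K',
        ((fockD4 γ).val * (fockTranslate v).val) *ᵥ w ∈ K') →
      K' = ⊥ ∨ K' = szSector N 0 ⊓ Module.End.eigenspace (Matrix.toLin' (hubbardTorus 2 L 1 U₀))
          (((hubbardTorus 2 L 1 U₀).minEnergyOn (szSector N 0) : ℝ) : ℂ))) :
    ∃ ε : ℝ, 0 < ε ∧ ∀ u ∈ Set.Ioo (U₀ - ε) (U₀ + ε),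
      ¬ (∀ K' : Submodule ℂ (Fock (Orb (FermionTorus 2 L))),
        K' ≤ szSector N 0 ⊓ Module.End.eigenspace (Matrix.toLin' (hubbardTorus 2 L 1 u))
            (((hubbardTorus 2 L 1 u).minEnergyOn (szSector N 0) : ℝ) : ℂ) →
        (∀ (γ : DihedralGroup 4) (v : TorusSite 2 L), ∀ w ∈ K',
          ((fockD4 γ).val * (fockTranslate v).val) *ᵥ w ∈ K') →
        K' = ⊥ ∨ K' = szSector N 0 ⊓ Module.End.eigenspace (Matrix.toLin' (hubbardTorus 2 L 1 u))
            (((hubbardTorus 2 L 1 u).minEnergyOn (szSector N 0) : ℝ) : ℂ)) := by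
  obtain ⟨ε, hε, hloc⟩ := irreducibilityLocallyConstant L N U₀ hgen
  exact ⟨ε, hε, fun u hu hirr => hred ((hloc u hu).1 hirr)⟩

end Summit.HubbardSuperconductivity.HubbardSuperconductivity.Theorems.JosephsonMirror

end
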